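import Summits.Ventures.HodgeRepro2.T6N43Explicit

/-!
# T6N43ExplicitConsumer — the (I-P2) binders of the M2 carrier from an explicit local datum

The M2 theorem (the lead's `periodInputN_of_published₃`, T6PeriodInput3.lean) carries, per side of the
seesaw, the three (I-P2) binders `hP2₁ : M.s.d43.d₁.CharacterCoefficient M.s.d43.m`,
`hP2₂ : M.s.d43.d₂.FockLineIdentification`, `hP2₃ : M.s.d43.d₃.FockLineIdentification` (class AD,
route/T6-N43-t6-p6.md §11.1). This file gives them away for free the moment the carrier's `d43` IS an
explicit bundle (`hx : D = X.toPlaces`, class EX — by construction when the carrier builds its local data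
from Fock-line / Fock-model data, the record's own construction R3.7): `N43Places.ExplicitPlaces.binders_of_eq`,
and the three binders one by one. Consumer shape for a `periodInputN_of_published₄`-type revision: the
binder `(hxA : M.sA.d43 = XA.toPlaces)` replaces `hP2₁A hP2₂A hP2₃A` through
`(XA.binders_of_eq _ hxA).1 / .2.1 / .2.2`. No display, no new definition. Axioms: {propext,
Classical.choice, Quot.sound}. §8(d): uses an L-value-free non-vanishing device: NO.
-/

namespace Summit.Ventures.HodgeRepro2.T6.N43Places.ExplicitPlaces

variable (X : ExplicitPlaces)

/-- The three (I-P2) binders of an abstract bundle `D` that IS the explicit bundle `X` — all three at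
once, from `hx : D = X.toPlaces` alone. -/
theorem binders_of_eq (D : N43Places) (hx : D = X.toPlaces) :
    D.d₁.CharacterCoefficient D.m ∧ D.d₂.FockLineIdentification ∧ D.d₃.FockLineIdentification := by
  subst hx
  exact ⟨X.p₁.datum_characterCoefficient, X.p₂.datum_fockLineIdentification,
    X.p₃.datum_fockLineIdentification⟩

/-- (I-P2) at τ′₁ of an abstract bundle that is explicit. -/
theorem characterCoefficient_of_eq (D : N43Places) (hx : D = X.toPlaces) :
    D.d₁.CharacterCoefficient D.m :=
  (X.binders_of_eq D hx).1

/-- (I-P2) at τ′₂ of an abstract bundle that is explicit. -/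
theorem fockLineIdentification₂_of_eq (D : N43Places) (hx : D = X.toPlaces) :
    D.d₂.FockLineIdentification :=
  (X.binders_of_eq D hx).2.1

/-- (I-P2) at τ′₃ of an abstract bundle that is explicit. -/
theorem fockLineIdentification₃_of_eq (D : N43Places) (hx : D = X.toPlaces) :
    D.d₃.FockLineIdentification :=
  (X.binders_of_eq D hx).2.2

/-- THEOREM N4.3 for an abstract bundle that is explicit, in the re-pointed (NSide) form: the (I-P2)
binders replaced by `hx`. -/
theorem N43_places_withLfac_of_eq (D : N43Places) (hx : D = X.toPlaces) (L : Fin 3 → ℂ → ℂ)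
    (hEL₁ : Hyp.EischenLiu2024_Sec2_2 2 0 D.τ₁ D.ν₁ D.r₁ (L 0))
    (hP2'₂ : D.d₂.LowestWeightCoefficient) (hA2f₂ : Hyp.Ruhl1970_A2f D.d₂)
    (hEL₂ : Hyp.EischenLiu2024_Sec2_2 1 1 D.τ₂ D.ν₂ D.r₂ (L 1))
    (hP2'₃ : D.d₃.LowestWeightCoefficient) (hA2f₃ : Hyp.Ruhl1970_A2f D.d₃)
    (hEL₃ : Hyp.EischenLiu2024_Sec2_2 1 1 D.τ₃ D.ν₃ D.r₃ (L 2)) :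
    (∀ j : Fin 3, 0 < ((D.withLfac L).zetaAt j).re) ∧ (D.withLfac L).ArchNonvanishing :=
  D.N43_places_withLfac L (X.characterCoefficient_of_eq D hx) hEL₁
    (X.fockLineIdentification₂_of_eq D hx) hP2'₂ hA2f₂ hEL₂ (X.fockLineIdentification₃_of_eq D hx)
    hP2'₃ hA2f₃ hEL₃

end Summit.Ventures.HodgeRepro2.T6.N43Places.ExplicitPlaces
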